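import Literature.NumberTheory.GaloisRepresentations.CharacterFromFrobeniusPair
import Literature.NumberTheory.GaloisRepresentations.FrobeniusDensityOneProofs
import Literature.NumberTheory.GaloisRepresentations.DegreeOnePlacesProofs
import HarnessLib

/-!
# Two alternatives at the Frobenius elements over a set of places of Dirichlet density one

Topic `Literature/NumberTheory/GaloisRepresentations`.  A *proofs* file (theorems only, no new
facts, no definitions), unconditional; the **density-one companion** of
`GaloisRepresentations/CharacterFromFrobeniusPair` (the cofinite / Frobenius-dense readings:
`ContinuousMonoidHom.eq_or_eq_of_dense`, `FramedGaloisRep.eq_or_eq_of_frobenius(_of_dense)`,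
`FramedGaloisRep.eq_or_eq_of_hasFrobCharpolyAt`, and the Hecke-character heads
`HeckeCharacter.IsAlgebraic.eq_or_eq_of_valueAtUniformizer…`, which are NOT restated here).

**The statement.**  Let `K` be a number field, `Γ_K = Field.absoluteGaloisGroup K`, and `𝓛` a set of
finite places of `K` of Dirichlet density one
(`Literature.NumberTheory.LFunctions.NumberField.HasDirichletDensity K 𝓛 1`; e.g. a cofinite set,
`hasDirichletDensity_one_of_cofinite`, or the places of residue degree one / split over a subfield
outside a finite set).  If continuous homomorphisms `ψ, χ₁, χ₂ : Γ_K → M` into a Hausdorff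
topological monoid satisfy `ψ Φ = χ₁ Φ` **or** `ψ Φ = χ₂ Φ` at every arithmetic Frobenius `Φ`
(`IsArithFrobAt (𝓞 K) Φ 𝔓`, `𝔓 ∈ v.primesAbove`) over every `v ∈ 𝓛`, then `ψ = χ₁` or `ψ = χ₂`
(`absoluteGaloisGroup.monoidHom_eq_or_eq_of_frobenius`; framed form
`FramedGaloisRep.eq_or_eq_of_frobenius_of_hasDirichletDensity_one`; rank-one characteristic-polynomial
form `FramedGaloisRep.eq_or_eq_of_hasFrobCharpolyAt_of_hasDirichletDensity_one`).

This is the reading of the step «`μ̃_𝔮 ∈ {μ_{1𝔮}, μ_{2𝔮}}` for all `𝔮 ∈ Σ(π^∞)` prime to `ℓ`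
⇒ `μ̃ ∈ {μ₁, μ₂}`» of the proof of [Liu2021, Thm. D.6 (1)] (App. D.4, after Cor. D.9) in which
the good set `Σ(π^∞)` — the degree-one primes with `π` unramified — enters through its DENSITY
(one), as in print; the printed proof then invokes [Rajan2000, Thm. 1] (positive upper density ⇒
`μ̃ = μ_i η_i`, `η_i` of finite order) and a weight argument.  Here neither a density-form
Chebotarev theorem nor a finite-order twist appears: the two coincidence sets
`H_i = {ψ = χ_i}` are CLOSED SUBGROUPS of `Γ_K` (Mathlib `MonoidHom.eqLocus`, `isClosed_eq`), so
`H₁ ∪ H₂` is a closed subset stable under powers containing the Frobenius elements over `𝓛`,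
hence all of `Γ_K` by the tree's proved density criterion
`absoluteGaloisGroup.eq_univ_of_frobenius_mem_of_hasDirichletDensity_one`
(`FrobeniusDensityOneProofs`; Frobenius' density theorem of 1896 suffices), and a group is never
the union of two proper subgroups
(`Literature.RepresentationTheory.Semisimple.subgroup_eq_top_or_eq_top_of_union`, by import).

Contents:
* `absoluteGaloisGroup.subgroup_eq_top_or_eq_top_of_frobenius_mem_union` — two closed subgroups
  of `Γ_K` whose union contains every arithmetic Frobenius over a density-one set of places: one
  of them is `Γ_K`;
* `absoluteGaloisGroup.monoidHom_eq_or_eq_of_frobenius` and the primed variant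
  `absoluteGaloisGroup.monoidHom_eq_or_eq_of_frobenius'` (topology carried by an injective map
  `M → X`, e.g. `Units.val`, as in `absoluteGaloisGroup.monoidHom_eq_of_frobenius'`);
* `FramedGaloisRep.eq_or_eq_of_frobenius_of_hasDirichletDensity_one` — continuous
  `Γ_K → GL_n(A)`, `A` a Hausdorff topological ring;
* `FramedGaloisRep.eq_or_eq_of_hasFrobCharpolyAt_of_hasDirichletDensity_one` — rank one, in the
  `HasFrobCharpolyAt v (X - C a)` currency (the shape `HeckeCharacter.IsAlgebraic.exists_lAdic`
  emits), over `CharacterFromFrobeniusPair`'s `FramedRep.apply_eq_of_charpoly_eq`;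
* `absoluteGaloisGroup.monoidHom_eq_or_eq_of_frobenius_of_prime_absNorm`,
  `FramedGaloisRep.eq_or_eq_of_hasFrobCharpolyAt_of_prime_absNorm` — the DEGREE-ONE reading
  (places of prime absolute norm outside a finite set), zero hypotheses, via the tree's
  `hasDirichletDensity_one_setOf_prime_absNorm` (`DegreeOnePlacesProofs`, Neukirch VII §13);
  and the helper `HasDirichletDensity.of_superset_of_one` for weaker place conditions.

Deliberately NOT here: the cofinite and `Dense`-parametrised forms and the Hecke-character side
(`CharacterFromFrobeniusPair`), and density / Frobenius-density statements for place sets given by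
a RELATIVE degree-one or splitting condition over a subfield (separate leaf; they follow from the
absolute case by `HasDirichletDensity.of_superset_of_one` when the condition is implied by «prime
absolute norm» off a finite set).

## References

* Y. Liu, *Fourier–Jacobi cycles and arithmetic relative trace formula*, Camb. J. Math. 9
  (2021), App. D, proof of Thm. D.6 (1). [Liu2021]
* C. S. Rajan, *Refinement of strong multiplicity one for automorphic representations of
  `GL(n)`*, Proc. AMS 128 (2000), 691–700, Theorem 1. [Rajan2000]
* J.-P. Serre, *Abelian `ℓ`-adic representations and elliptic curves* (1968), Ch. I §2.2,
  Cor. 2 (a). [SerreAbelianLadic1968]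
* D. Marcus, *Number Fields*, 2nd ed. (2018), Ch. 7, Exercise 12 (f) (Frobenius' density
  theorem). [Marcus2018]
* J. Neukirch, *Algebraic Number Theory* (1999), Ch. VII §13, (13.1) and the remark after it
  (p. 543: Dirichlet density; degree-one primes carry it). [NeukirchANT1999]
-/

noncomputable section

open NumberField IsDedekindDomain Filter Topology Polynomial
open scoped Classical

namespace Literature.NumberTheory.GaloisRepresentations

open Literature.NumberTheory.LFunctions Literature.NumberTheory.LFunctions.NumberField

section DensityOne

open Field

variable {K : Type} [Field K] [NumberField K]

/-! ### Two closed subgroups of `Γ_K` covering the Frobenius elements over a density-one set -/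

/-- **Two closed subgroups of `Γ_K` whose union contains every arithmetic Frobenius over a set of
places of Dirichlet density one: one of them is `Γ_K`.**  Let `𝓛` be a set of finite places of
the number field `K` of Dirichlet density `1`, and `H₁, H₂ ≤ Γ_K` closed subgroups such that every
`Φ ∈ Γ_K` which is an arithmetic Frobenius at some prime of `\bar ℤ_K` above some `v ∈ 𝓛` lies
in `H₁ ∪ H₂`.  Then `H₁ = Γ_K` or `H₂ = Γ_K`.  Proof: `H₁ ∪ H₂` is closed and stable under powers,
so it is all of `Γ_K` by the density criterion
`absoluteGaloisGroup.eq_univ_of_frobenius_mem_of_hasDirichletDensity_one` (Frobenius' theorem);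
conclude by `Literature.RepresentationTheory.Semisimple.subgroup_eq_top_or_eq_top_of_union`.
[cite: SerreAbelianLadic1968, Ch. I §2.2, Cor. 2 (a)] [cite: Marcus2018, Ch. 7, Exercise 12 (f)] -/
theorem absoluteGaloisGroup.subgroup_eq_top_or_eq_top_of_frobenius_mem_union
    {H₁ H₂ : Subgroup (absoluteGaloisGroup K)}
    (h₁ : IsClosed (H₁ : Set (absoluteGaloisGroup K)))
    (h₂ : IsClosed (H₂ : Set (absoluteGaloisGroup K)))
    {𝓛 : Set (HeightOneSpectrum (𝓞 K))} (h𝓛 : HasDirichletDensity K 𝓛 1)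
    (hFrob : ∀ v ∈ 𝓛, ∀ 𝔓 ∈ v.primesAbove, ∀ Φ : absoluteGaloisGroup K,
      IsArithFrobAt (𝓞 K) Φ 𝔓 → Φ ∈ H₁ ∨ Φ ∈ H₂) :
    H₁ = ⊤ ∨ H₂ = ⊤ := by
  have huniv : (H₁ : Set (absoluteGaloisGroup K)) ∪ (H₂ : Set (absoluteGaloisGroup K)) = Set.univ := by
    refine absoluteGaloisGroup.eq_univ_of_frobenius_mem_of_hasDirichletDensity_one (h₁.union h₂)
      (fun σ hσ k _ ↦ ?_) h𝓛 (fun v hv 𝔓 h𝔓 Φ hΦ ↦ hFrob v hv 𝔓 h𝔓 Φ hΦ)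
    rcases hσ with hσ | hσ
    · exact Or.inl (H₁.pow_mem hσ k)
    · exact Or.inr (H₂.pow_mem hσ k)
  refine Literature.RepresentationTheory.Semisimple.subgroup_eq_top_or_eq_top_of_union H₁ H₂
    fun g ↦ ?_
  have hg : g ∈ (H₁ : Set (absoluteGaloisGroup K)) ∪ (H₂ : Set (absoluteGaloisGroup K)) := by
    rw [huniv]; exact Set.mem_univ g
  exact hg

/-! ### Homomorphisms with two alternatives at the Frobenius elements over a density-one set -/

/-- **Two-alternatives rigidity for continuous homomorphisms on `Γ_K`, density-one form.**  Let `M`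
be a Hausdorff topological monoid, `𝓛` a set of finite places of `K` of Dirichlet density one, and
`ψ χ₁ χ₂ : Γ_K →* M` continuous such that at every arithmetic Frobenius `Φ` above every `v ∈ 𝓛`
one has `ψ Φ = χ₁ Φ` or `ψ Φ = χ₂ Φ`.  Then `ψ = χ₁` or `ψ = χ₂`: the coincidence sets are the
closed subgroups `ψ.eqLocus χ_i` (`isClosed_eq`), and
`absoluteGaloisGroup.subgroup_eq_top_or_eq_top_of_frobenius_mem_union` applies.  Galois-side form
of the step «`μ̃_𝔮 ∈ {μ_{1𝔮}, μ_{2𝔮}}` on the density-one set `Σ(π^∞)` ⇒ `μ̃ ∈ {μ₁, μ₂}`» in the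
proof of [Liu2021, Thm. D.6 (1)], there deduced from [Rajan2000, Thm. 1]; here no finite-order
twist arises.  (Cofinite / `Dense` readings: `CharacterFromFrobeniusPair`.)
[cite: Liu2021, App. D, proof of Thm. D.6 (1) (the claim `μ̃ ∈ {μ₁, μ₂}`)]
[cite: Rajan2000, Theorem 1] -/
theorem absoluteGaloisGroup.monoidHom_eq_or_eq_of_frobenius {M : Type*} [Monoid M]
    [TopologicalSpace M] [T2Space M]
    {𝓛 : Set (HeightOneSpectrum (𝓞 K))} (h𝓛 : HasDirichletDensity K 𝓛 1)
    {ψ χ₁ χ₂ : absoluteGaloisGroup K →* M} (hψ : Continuous ψ) (hχ₁ : Continuous χ₁)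
    (hχ₂ : Continuous χ₂)
    (hFrob : ∀ v ∈ 𝓛, ∀ 𝔓 ∈ v.primesAbove, ∀ Φ : absoluteGaloisGroup K,
      IsArithFrobAt (𝓞 K) Φ 𝔓 → ψ Φ = χ₁ Φ ∨ ψ Φ = χ₂ Φ) :
    ψ = χ₁ ∨ ψ = χ₂ := by
  have h := absoluteGaloisGroup.subgroup_eq_top_or_eq_top_of_frobenius_mem_union
    (H₁ := ψ.eqLocus χ₁) (H₂ := ψ.eqLocus χ₂) (isClosed_eq hψ hχ₁) (isClosed_eq hψ hχ₂) h𝓛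
    (fun v hv 𝔓 h𝔓 Φ hΦ ↦ hFrob v hv 𝔓 h𝔓 Φ hΦ)
  rcases h with h | h
  · exact Or.inl (MonoidHom.eq_of_eqOn_top fun x _ ↦ (h ▸ Subgroup.mem_top x : x ∈ ψ.eqLocus χ₁))
  · exact Or.inr (MonoidHom.eq_of_eqOn_top fun x _ ↦ (h ▸ Subgroup.mem_top x : x ∈ ψ.eqLocus χ₂))

/-- **Two-alternatives rigidity, density-one form, topology carried by an auxiliary map.**  `M`
any monoid, `f : M → X` injective into a Hausdorff space with `f ∘ ψ`, `f ∘ χ₁`, `f ∘ χ₂`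
continuous (typical use: `M = Eˣ`, `X = E`, `f = Units.val` for characters valued in the units of
a topological field).  If `ψ Φ = χ₁ Φ ∨ ψ Φ = χ₂ Φ` at every arithmetic Frobenius above every
place of a density-one set `𝓛`, then `ψ = χ₁ ∨ ψ = χ₂`.
[cite: Liu2021, App. D, proof of Thm. D.6 (1) (the claim `μ̃ ∈ {μ₁, μ₂}`)] -/
theorem absoluteGaloisGroup.monoidHom_eq_or_eq_of_frobenius' {M X : Type*} [Monoid M]
    [TopologicalSpace X] [T2Space X] {f : M → X} (hf : Function.Injective f)
    {𝓛 : Set (HeightOneSpectrum (𝓞 K))} (h𝓛 : HasDirichletDensity K 𝓛 1)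
    {ψ χ₁ χ₂ : absoluteGaloisGroup K →* M} (hψ : Continuous (f ∘ ψ)) (hχ₁ : Continuous (f ∘ χ₁))
    (hχ₂ : Continuous (f ∘ χ₂))
    (hFrob : ∀ v ∈ 𝓛, ∀ 𝔓 ∈ v.primesAbove, ∀ Φ : absoluteGaloisGroup K,
      IsArithFrobAt (𝓞 K) Φ 𝔓 → ψ Φ = χ₁ Φ ∨ ψ Φ = χ₂ Φ) :
    ψ = χ₁ ∨ ψ = χ₂ := by
  have hcl : ∀ χ : absoluteGaloisGroup K →* M, Continuous (f ∘ χ) →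
      IsClosed ((ψ.eqLocus χ : Subgroup (absoluteGaloisGroup K)) : Set (absoluteGaloisGroup K)) := by
    intro χ hχ
    have h : ((ψ.eqLocus χ : Subgroup (absoluteGaloisGroup K)) : Set (absoluteGaloisGroup K)) =
        {x | (f ∘ ψ) x = (f ∘ χ) x} := by
      ext x
      exact ⟨fun hx ↦ congrArg f hx, fun hx ↦ hf hx⟩
    rw [h]
    exact isClosed_eq hψ hχ
  have h := absoluteGaloisGroup.subgroup_eq_top_or_eq_top_of_frobenius_mem_union
    (H₁ := ψ.eqLocus χ₁) (H₂ := ψ.eqLocus χ₂) (hcl χ₁ hχ₁) (hcl χ₂ hχ₂) h𝓛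
    (fun v hv 𝔓 h𝔓 Φ hΦ ↦ hFrob v hv 𝔓 h𝔓 Φ hΦ)
  rcases h with h | h
  · exact Or.inl (MonoidHom.eq_of_eqOn_top fun x _ ↦ (h ▸ Subgroup.mem_top x : x ∈ ψ.eqLocus χ₁))
  · exact Or.inr (MonoidHom.eq_of_eqOn_top fun x _ ↦ (h ▸ Subgroup.mem_top x : x ∈ ψ.eqLocus χ₂))

/-! ### Framed Galois representations over a density-one set -/

/-- **Two-alternatives rigidity for continuous Galois representations, density-one form.**  Let `A`
be a Hausdorff topological ring and `ρ ρ₁ ρ₂ : Γ_K →ₜ* GL_n(A)` (`FramedGaloisRep K A n`) such that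
at every arithmetic Frobenius `Φ` above every place of a set `𝓛` of Dirichlet density one,
`ρ Φ = ρ₁ Φ` or `ρ Φ = ρ₂ Φ`.  Then `ρ = ρ₁` or `ρ = ρ₂` (equality, not merely isomorphism).
(The cofinite reading is `FramedGaloisRep.eq_or_eq_of_frobenius` of `CharacterFromFrobeniusPair`.)
[cite: Liu2021, App. D, proof of Thm. D.6 (1) (the claim `μ̃ ∈ {μ₁, μ₂}`)]
[cite: Rajan2000, Theorem 1] -/
theorem FramedGaloisRep.eq_or_eq_of_frobenius_of_hasDirichletDensity_one {A : Type*} [CommRing A]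
    [TopologicalSpace A] [T2Space A] {n : ℕ} (ρ ρ₁ ρ₂ : FramedGaloisRep K A n)
    {𝓛 : Set (HeightOneSpectrum (𝓞 K))} (h𝓛 : HasDirichletDensity K 𝓛 1)
    (hFrob : ∀ v ∈ 𝓛, ∀ 𝔓 ∈ v.primesAbove, ∀ Φ : absoluteGaloisGroup K,
      IsArithFrobAt (𝓞 K) Φ 𝔓 → ρ Φ = ρ₁ Φ ∨ ρ Φ = ρ₂ Φ) :
    ρ = ρ₁ ∨ ρ = ρ₂ := by
  have h := absoluteGaloisGroup.monoidHom_eq_or_eq_of_frobenius (M := GL (Fin n) A) h𝓛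
    (ψ := ρ.toMonoidHom) (χ₁ := ρ₁.toMonoidHom) (χ₂ := ρ₂.toMonoidHom)
    ρ.continuous ρ₁.continuous ρ₂.continuous (fun v hv 𝔓 h𝔓 Φ hΦ ↦ hFrob v hv 𝔓 h𝔓 Φ hΦ)
  rcases h with h | h
  · exact Or.inl (ContinuousMonoidHom.ext fun σ ↦ DFunLike.congr_fun h σ)
  · exact Or.inr (ContinuousMonoidHom.ext fun σ ↦ DFunLike.congr_fun h σ)

/-- **Rank-one characteristic-polynomial form over a density-one set** (the currency
`FramedGaloisRep.HasFrobCharpolyAt v (X - C a)` = «`χ(Frob_v) = a`» that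
`HeckeCharacter.IsAlgebraic.exists_lAdic` delivers).  Let `χ χ₁ χ₂ : Γ_K →ₜ* GL_1(A)` (`A` a
Hausdorff topological ring) and `𝓛` a set of places of Dirichlet density one such that at every
`v ∈ 𝓛` there are `a a₁ a₂ : A` with `χ`, `χ₁`, `χ₂` having arithmetic-Frobenius characteristic
polynomials `X - C a`, `X - C a₁`, `X - C a₂` at `v` and `a = a₁ ∨ a = a₂`.  Then `χ = χ₁` or
`χ = χ₂` — the `ℓ`-adic-character statement behind the claim `μ̃ ∈ {μ₁, μ₂}` of
[Liu2021, Thm. D.6 (1)] read over the density-one set `Σ(π^∞)` of degree-one good primes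
(rank-one step: `FramedRep.apply_eq_of_charpoly_eq` of `CharacterFromFrobeniusPair`).
[cite: Liu2021, App. D, proof of Thm. D.6 (1) (the claim `μ̃ ∈ {μ₁, μ₂}`)]
[cite: Rajan2000, Theorem 1] -/
theorem FramedGaloisRep.eq_or_eq_of_hasFrobCharpolyAt_of_hasDirichletDensity_one {A : Type*}
    [CommRing A] [TopologicalSpace A] [T2Space A] (χ χ₁ χ₂ : FramedGaloisRep K A 1)
    {𝓛 : Set (HeightOneSpectrum (𝓞 K))} (h𝓛 : HasDirichletDensity K 𝓛 1)
    (h : ∀ v ∈ 𝓛, ∃ a a₁ a₂ : A, χ.HasFrobCharpolyAt v (X - C a) ∧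
      χ₁.HasFrobCharpolyAt v (X - C a₁) ∧ χ₂.HasFrobCharpolyAt v (X - C a₂) ∧ (a = a₁ ∨ a = a₂)) :
    χ = χ₁ ∨ χ = χ₂ := by
  refine FramedGaloisRep.eq_or_eq_of_frobenius_of_hasDirichletDensity_one χ χ₁ χ₂ h𝓛
    fun v hv 𝔓 h𝔓 Φ hΦ ↦ ?_
  obtain ⟨a, a₁, a₂, ha, ha₁, ha₂, haa⟩ := h v hv
  have e := ha 𝔓 h𝔓 Φ hΦ
  have e₁ := ha₁ 𝔓 h𝔓 Φ hΦ
  have e₂ := ha₂ 𝔓 h𝔓 Φ hΦ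
  rcases haa with haa | haa
  · exact Or.inl (FramedRep.apply_eq_of_charpoly_eq (e.trans (haa ▸ e₁.symm)))
  · exact Or.inr (FramedRep.apply_eq_of_charpoly_eq (e.trans (haa ▸ e₂.symm)))

/-! ### The degree-one reading: places of prime absolute norm outside a finite set -/

/-- **Supersets of density-one sets have density one** (`d(Pᶜ) ≤ d(Tᶜ) = 0` for `T ⊆ P` of
density one; complements `HasDirichletDensity.compl` and the squeeze `mono_zero`).  Recorded here
for consumers who carry a place condition WEAKER than «prime absolute norm» (e.g. residue degree
one over, or split over, a subfield). [cite: NeukirchANT1999, Ch. VII (13.1)] -/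
theorem _root_.Literature.NumberTheory.LFunctions.NumberField.HasDirichletDensity.of_superset_of_one
    {P T : Set (HeightOneSpectrum (𝓞 K))} (hTP : T ⊆ P) (hT : HasDirichletDensity K T 1) :
    HasDirichletDensity K P 1 := by
  have h0 : HasDirichletDensity K Pᶜ 0 := by
    have h := hT.compl
    rw [sub_self] at h
    exact h.mono_zero (Set.compl_subset_compl.mpr hTP)
  have h1 := h0.compl
  rw [compl_compl, sub_zero] at h1
  exact h1

/-- **Two-alternatives rigidity at the places of degree one** — the literal reading of
[Liu2021, Thm. D.6 (1)]'s «for every `𝔮 ∈ Σ(π^∞)` (degree-one primes, `π` unramified) …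
`μ̃_𝔮 ∈ {μ_{1𝔮}, μ_{2𝔮}}` ⇒ `μ̃ ∈ {μ₁, μ₂}`»: continuous `ψ χ₁ χ₂ : Γ_K →* M` (`M` Hausdorff) with
`ψ Φ = χ₁ Φ ∨ ψ Φ = χ₂ Φ` at every arithmetic Frobenius above every place `v ∉ S` of PRIME
ABSOLUTE NORM (`S` finite) satisfy `ψ = χ₁ ∨ ψ = χ₂`.  The place set has Dirichlet density one by
the tree's `hasDirichletDensity_one_setOf_prime_absNorm` (Neukirch VII §13, remark after (13.1), p. 543) and
`HasDirichletDensity.diff_of_finite`; no Chebotarev-type input beyond Frobenius' theorem.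
[cite: Liu2021, App. D, proof of Thm. D.6 (1) (the claim `μ̃ ∈ {μ₁, μ₂}`)]
[cite: NeukirchANT1999, Ch. VII §13, remark after (13.1) (p. 543)] -/
theorem absoluteGaloisGroup.monoidHom_eq_or_eq_of_frobenius_of_prime_absNorm {M : Type*} [Monoid M]
    [TopologicalSpace M] [T2Space M] {S : Set (HeightOneSpectrum (𝓞 K))} (hS : S.Finite)
    {ψ χ₁ χ₂ : absoluteGaloisGroup K →* M} (hψ : Continuous ψ) (hχ₁ : Continuous χ₁)
    (hχ₂ : Continuous χ₂)
    (hFrob : ∀ v ∉ S, (Ideal.absNorm v.asIdeal).Prime → ∀ 𝔓 ∈ v.primesAbove,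
      ∀ Φ : absoluteGaloisGroup K, IsArithFrobAt (𝓞 K) Φ 𝔓 → ψ Φ = χ₁ Φ ∨ ψ Φ = χ₂ Φ) :
    ψ = χ₁ ∨ ψ = χ₂ :=
  absoluteGaloisGroup.monoidHom_eq_or_eq_of_frobenius
    ((hasDirichletDensity_one_setOf_prime_absNorm K).diff_of_finite hS) hψ hχ₁ hχ₂
    fun v hv 𝔓 h𝔓 Φ hΦ ↦ hFrob v hv.2 hv.1 𝔓 h𝔓 Φ hΦ

/-- **Rank-one characteristic-polynomial form at the places of degree one**: rank-one
`χ χ₁ χ₂ : Γ_K →ₜ* GL_1(A)` (`A` Hausdorff) with arithmetic-Frobenius characteristic polynomials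
`X - C a`, `X - C a₁`, `X - C a₂` and `a = a₁ ∨ a = a₂` at every place `v ∉ S` of prime absolute
norm (`S` finite) satisfy `χ = χ₁ ∨ χ = χ₂` — the `ℓ`-adic statement that step 3 of the d6
composition consumes when the congruence-relation / local-parameter inputs are stated at the
degree-one good places only.
[cite: Liu2021, App. D, proof of Thm. D.6 (1) (the claim `μ̃ ∈ {μ₁, μ₂}`)]
[cite: NeukirchANT1999, Ch. VII §13, remark after (13.1) (p. 543)] -/
theorem FramedGaloisRep.eq_or_eq_of_hasFrobCharpolyAt_of_prime_absNorm {A : Type*}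
    [CommRing A] [TopologicalSpace A] [T2Space A] (χ χ₁ χ₂ : FramedGaloisRep K A 1)
    {S : Set (HeightOneSpectrum (𝓞 K))} (hS : S.Finite)
    (h : ∀ v ∉ S, (Ideal.absNorm v.asIdeal).Prime → ∃ a a₁ a₂ : A,
      χ.HasFrobCharpolyAt v (X - C a) ∧ χ₁.HasFrobCharpolyAt v (X - C a₁) ∧
        χ₂.HasFrobCharpolyAt v (X - C a₂) ∧ (a = a₁ ∨ a = a₂)) :
    χ = χ₁ ∨ χ = χ₂ :=
  FramedGaloisRep.eq_or_eq_of_hasFrobCharpolyAt_of_hasDirichletDensity_one χ χ₁ χ₂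
    ((hasDirichletDensity_one_setOf_prime_absNorm K).diff_of_finite hS)
    fun v hv ↦ h v hv.2 hv.1

end DensityOne

end Literature.NumberTheory.GaloisRepresentations
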